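import Summits.HubbardSuperconductivity.HubbardSuperconductivity.Theses.KkFloor
import Summits.HubbardSuperconductivity.HubbardSuperconductivity.Theorems.KkBandLift.Negative.NotKkBandLiftOfThermalShell
import Summits.HubbardSuperconductivity.HubbardSuperconductivity.Theorems.KkBandLift.Negative.ThermalShellWitness
import Summits.HubbardSuperconductivity.HubbardSuperconductivity.Theorems.KkFloorBandGlue
import HarnessLib

/-!
# Route `KkFloor`: refutation of the crux `KkZenoShelf` (stmt-HubbardSuperconductivity-10403)

`KkZenoShelf` (large-`y` Zeno shelf): `∃ U > 0, δ ∈ (0,½), ε > 0, Y > 0, L₀` such that for every even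
`L ≥ L₀`, every `y ≥ Y` and every eigenvector of `H_L + iy L⁻²Δ_d†Δ_d` in the doped sector,
`Re λ ≥ minEnergyOn + εL²`.  FALSE: the proved glue `kkShelfGivesBand_proof : KkZenoShelf → KkBandLift`
(`Theorems/KkFloorBandGlue.lean`, the band `[Y, 2Y]`) and `¬ KkBandLift`
(`kkBandLift_false_of_thermalShellWitness` + `thermalShellWitness_of_mem_Ioo`; see
`KkFloorKkBandLiftRefutation.lean`).  Witness: the thermal-shell vector at budget
`c = εY/(4π(1+4Y²))` on an even side beyond `L₀` and the witness threshold.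

CLASS `refuted-substantive`: the band / shelf / window is demanded of ALL eigenvectors of the
pair-penalised pencil in the doped sector, uniformly `Ω(L²)` above the sector ground energy; the
sector always contains unit vectors of energy `≤ E₀ + cL²` with d-wave pair intensity `≤ cL⁴` for
every `c > 0` (thermal shell: Koma–Tasaki decay in the canonical-sector Gibbs state at `β = 4/c`,
entropy budget, ground vector of the budget operator), and the fixed-height Kramers–Kronig floor
(`finiteXFloor`) converts a lift that holds on the whole sector spectrum into
`Ω(L²)` energy-or-pair-order for EVERY unit sector vector — contradiction.  Repairs tried, each still
killed or leaving the route: (i) smaller `ε`, other bands `[Y₁,Y₂]` / thresholds `Y` / windows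
`|y| ≤ y₁` — the witness beats every fixed positive constant; (ii) other couplings / fillings — the
witness holds for all `U : ℝ`, all `δ ≥ -1`; (iii) restricting the lift to eigenvectors near the
bottom of the spectrum — then it is no longer the hypothesis `KkFloorTheorem` / the route glue
consume (a planner's restatement, not a repair of this decl).
barrier-candidate: "thermal-shell census" — no spectral statement quantified over all eigenvectors of
a fixed-sector pair-penalised pencil `H + iyL⁻²Δ†Δ` on the 2D Hubbard torus can carry an `Ω(L²)`
lift, because positive-temperature canonical states have no pair LRO (Koma–Tasaki 1992).

HONEST FRAMING: a DECIDABLE VERDICT (kernel-checked refutation closing a route item), not summit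
progress.  Sources: T. Koma, H. Tasaki, Phys. Rev. Lett. 68 (1992) 3248 (Theorem, eq. (2), (3),
footnote [10]); T. Ransford, Potential Theory in the Complex Plane (1995), Thm 6.4.2.
No definitions.
-/

-- the mandated namespace `Summit.<Summit>.<Problem>.Theorems…` repeats `HubbardSuperconductivity`
-- (single-problem summit, D-0017), which the `dupNamespace` linter flags on every declaration
set_option linter.dupNamespace false

namespace Summit.HubbardSuperconductivity.HubbardSuperconductivity.Theorems

open Summit.HubbardSuperconductivity.HubbardSuperconductivity.Theorems.KkBandLift.Negative
  (kkBandLift_false_of_thermalShellWitness thermalShellWitness_of_mem_Ioo)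

/-- Refutes `KkFloor.KkZenoShelf` [refuted-substantive]: no `(U, δ, ε, Y, L₀)` gives an `εL²` lift of
the whole doped-sector spectrum of `H_L + iyL⁻²Δ_d†Δ_d` for all `y ≥ Y`; witness = shelf ⇒ band on
`[Y,2Y]` (`kkShelfGivesBand_proof`) ⇒ thermal-shell contradiction; no cheap repair (module docstring);
barrier-candidate: thermal-shell census. [folklore] -/
theorem KkFloorKkZenoShelf_refuted :
    ¬ Summit.HubbardSuperconductivity.HubbardSuperconductivity.Theses.KkFloor.KkZenoShelf :=
  fun h => kkBandLift_false_of_thermalShellWitness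
    (fun U δ _ hδ c hc => thermalShellWitness_of_mem_Ioo U δ hδ c hc) (kkShelfGivesBand_proof h)

end Summit.HubbardSuperconductivity.HubbardSuperconductivity.Theorems
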